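import Summits.Ventures.LatticeQCDFlow.Scaling.DominatedStarRegimeFreeRelaxation
import Literature.Probability.MarkovChains.FiniteDoeblinCondition
import Literature.Probability.MarkovChains.TimeAverageConcentration
import Literature.Probability.MarkovChains.MengersenTweedie
import Literature.Probability.MarkovChains.DoeblinCesaroAverages

/-!
HONEST FRAMING: exact (Metropolis-corrected) sampling algorithms for lattice gauge theory; figures
of merit are autocorrelation/cost numbers at stated couplings and volumes; no continuum-physics
claim.

# RefreshThenProposeMixing — A RANDOM-SCAN PRODUCT OF MINORISED STATIONARY KERNELS HAS `Qⁿ(x,·) ≥ (1 − Σ_k(1 − w_kβ_k)ⁿ)·π̃`, HENCE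
# `d(n) ≤ Σ_k (1 − w_kβ_k)ⁿ`; THE REFRESH-THEN-PROPOSE TEMPERING STAR (A FRESH HOT DRAW BEFORE EVERY MAP-ASSISTED PROPOSAL = `K` INDEPENDENCE
# SAMPLERS WITH WEIGHTS `≤ 1/p`) THEREFORE MIXES IN `⌈(K/p)·log(K/ε)⌉` STEPS — VOLUME-FREE, REGIME-FREE, POLYNOMIAL IN `K` (lean-2 GEN-28, ours)

Venture-side (OURS).  Cell `lqcd-flow` (pub-lqcd), unit `pub-lqcd-lean-2-g28`, 2026-08-28.  Chapter N, file 21: the comparison point OPEN-MATH-chapterM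
item 1 should be measured against.  §1 (any finite product `Π_j X_j`): coordinate kernels `P_j`, each row-stochastic, `π_j`-stationary and
MINORISED `P_j(u,·) ≥ β_j·π_j` (`0 ≤ β_j ≤ 1`), selection weights `w` (`≥ 0`, `Σw = 1`), `Q = Σ_j w_j P̃_j` the random-scan product chain of
Levin–Peres–Wilmer eq. (12.22).  Because `P_j` FIXES `π_j` ON ITS OWN COORDINATE, a refreshed coordinate stays refreshed: by induction on `n`, with
the tensor kernel `T_jv(x,y) = Π_k P_k^{jv_k}(x_k,y_k)` of independent offsets `jv`, `(T_jvQⁿ)(x,y) ≥ (1 − Σ_k (1−β_k)^{jv_k}(1 − w_kβ_k)ⁿ)·π̃(y)`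
(`T_jv·P̃_k = T_{jv+e_k}`, `Σ_{k'} w_{k'}(1−β_k)^{[k=k']} = 1 − w_kβ_k`, and `P^j(u,·) ≥ (1 − (1−β)^j)π` for one minorised stationary kernel); at
`jv = 0`: `Qⁿ(x,·) ≥ (1 − Σ_k(1 − w_kβ_k)ⁿ)·π̃`, so `d(n) ≤ Σ_k (1 − w_kβ_k)ⁿ` (Doeblin at `k = n`).  §2: the REFRESH-THEN-PROPOSE star — levels
`k = 1..K` with targets `μ_k`, at each step a level `k` is chosen with weight `w′_k`, a FRESH `ξ ~ μ_0` is drawn and `φ_k ξ` proposed to level `k`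
with the Metropolis–Hastings ratio of the independence proposal `μ_0∘φ_k⁻¹` — is such a product with `β_k = p` under the one-sided domination
`p·μ_k(φ_k u) ≤ μ_0(u)` (Mengersen–Tweedie's minorisation, in the tree), whence `d(n) ≤ Σ_k(1 − w′_k p)ⁿ` and, at uniform weights,
`t_mix(ε) ≤ ⌈(K/p)·log(K/ε)⌉`.

## What is proved

* §1 **`pow_apply_ge_of_minorized`** — one kernel: `P^j(u,v) ≥ (1 − (1−β)^j)·π(v)`; **`sum_mul_coordKernel`** (column sums of `P̃_k`);
  **`tensorPow_mul_coordKernel`** (`T_jv·P̃_k = T_{jv+e_k}`); **`one_sub_sum_le_prod`** (`1 − Σa_k ≤ Π(1 − a_k)` on `[0,1]`);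
  **`tensorPow_mul_prodKernel_pow_ge`** (the induction); **`prodKernel_pow_ge_tensorFun`** — `Qⁿ(x,y) ≥ (1 − Σ_k(1 − w_kβ_k)ⁿ)·π̃(y)`;
  **`prodKernel_worstTvDist_le_sum`** — `d(n) ≤ Σ_k (1 − w_kβ_k)ⁿ` (reversible coordinates).
* §2 **`refreshThenPropose_minorized`** — the level-`k` independence sampler is minorised by `p·μ_k`; **`refreshThenPropose_worstTvDist_le`** —
  `d(n) ≤ Σ_k (1 − w′_k p)ⁿ`; **`refreshThenPropose_mixingTime_le`** — uniform weights: `t_mix(ε) ≤ ⌈(K/p)·log(K/ε)⌉`.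

Reading (no numerics implied): paying one hot draw per swap test buys a cold-start law that is polynomial in `K` and free of the volume and of any
regime — `K·log(K/ε)/p` (hot draw + swap test) pairs to `ε`-mix — whereas the persistent hub of chapters M/N (one hot draw shared by `t/h` tests)
has, outside the regime, only the quadratic theory (`7K(κ_s+κ_u)/p` per relaxation time) and volume-logarithmic or exponential-in-`K` cold-start
laws on record.  NOT CLAIMED: that the persistent hub is slower in fact (item 1 open for `K ≥ 2`); anything measured.  Literature grade (cell rule):
OWN RESULT (folklore-level product-chain minorisation) on the tree's [MengersenTweedie1996] minorisation and [Saloffcoste1997, Thm 1.2.7]; no new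
bib keys.
-/

noncomputable section

open Finset Function Matrix
open Literature.Probability.MarkovChains

namespace Summit.Ventures.LatticeQCDFlow.Scaling

/-! ## §1 Random-scan products of minorised stationary kernels -/

section OneKernel
variable {Y : Type*} [Fintype Y] [DecidableEq Y]

/-- **One minorised stationary kernel: `P^j(u,v) ≥ (1 − (1−β)^j)·π(v)`** (`P` row-stochastic, `πP = π`, `Σπ = 1`, `P(u,·) ≥ β·π`). [ours] -/
theorem pow_apply_ge_of_minorized {P : Matrix Y Y ℝ} (hP : IsRowStochastic P) {π : Y → ℝ} (hst : IsStationary π P)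
    (hπ1 : ∑ y, π y = 1) {β : ℝ} (hmin : ∀ u v, β * π v ≤ P u v) :
    ∀ (j : ℕ) (u v : Y), (1 - (1 - β) ^ j) * π v ≤ (P ^ j) u v := by
  intro j
  induction j with
  | zero =>
    intro u v
    rw [pow_zero, pow_zero, sub_self, zero_mul, Matrix.one_apply]
    split_ifs <;> norm_num
  | succ j ih =>
    intro u v
    rw [show P ^ (j + 1) = P ^ j * P from pow_succ P j, Matrix.mul_apply]
    -- `Σ_z P^j(u,z)P(z,v) = βπ(v) + Σ_z P^j(u,z)(P(z,v) − βπ(v)) ≥ βπ(v) + (1 − (1−β)^j)·Σ_z π(z)(P(z,v) − βπ(v))`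
    have hrow : ∑ z, (P ^ j) u z = 1 := (hP.matPow j).2 u
    have hres : ∑ z, (P ^ j) u z * (P z v - β * π v) = ∑ z, (P ^ j) u z * P z v - (∑ z, (P ^ j) u z) * (β * π v) := by
      rw [sum_mul, ← sum_sub_distrib]
      exact sum_congr rfl fun z _ => by ring
    rw [hrow, one_mul] at hres
    have hlow : ∑ z, (1 - (1 - β) ^ j) * π z * (P z v - β * π v) ≤ ∑ z, (P ^ j) u z * (P z v - β * π v) :=
      sum_le_sum fun z _ => mul_le_mul_of_nonneg_right (ih u z) (sub_nonneg.mpr (hmin z v))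
    have hval : ∑ z, (1 - (1 - β) ^ j) * π z * (P z v - β * π v) = (1 - (1 - β) ^ j) * (π v - β * π v) := by
      have h1 : ∑ z, (1 - (1 - β) ^ j) * π z * (P z v - β * π v)
          = (1 - (1 - β) ^ j) * (∑ z, π z * P z v - β * π v * ∑ z, π z) := by
        rw [mul_sum, mul_sub, mul_sum, mul_sum, ← sum_sub_distrib]
        exact sum_congr rfl fun z _ => by ring
      rw [h1, hst v, hπ1, mul_one]
    have hkey : (1 - (1 - β) ^ (j + 1)) * π v = β * π v + (1 - (1 - β) ^ j) * (π v - β * π v) := by ring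
    linarith

/-- `1 − Σ_k a_k ≤ Π_k (1 − a_k)` for `a_k ∈ [0,1]`. [folklore] -/
theorem one_sub_sum_le_prod {ι : Type*} (s : Finset ι) {a : ι → ℝ} (h0 : ∀ i ∈ s, 0 ≤ a i) (h1 : ∀ i ∈ s, a i ≤ 1) :
    1 - ∑ i ∈ s, a i ≤ ∏ i ∈ s, (1 - a i) := by
  classical
  induction s using Finset.induction_on with
  | empty => simp
  | insert i s hi ih =>
    rw [sum_insert hi, prod_insert hi]
    have h0' : ∀ k ∈ s, 0 ≤ a k := fun k hk => h0 k (mem_insert_of_mem hk)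
    have h1' : ∀ k ∈ s, a k ≤ 1 := fun k hk => h1 k (mem_insert_of_mem hk)
    have hih := ih h0' h1'
    have hai0 := h0 i (mem_insert_self i s)
    have hai1 := h1 i (mem_insert_self i s)
    have hprod1 : ∏ k ∈ s, (1 - a k) ≤ 1 := prod_le_one (fun k hk => sub_nonneg.mpr (h1' k hk)) (fun k hk => by linarith [h0' k hk])
    nlinarith

end OneKernel

section Product
variable {d : ℕ} {X : Fin d → Type*} [∀ j, Fintype (X j)] [∀ j, DecidableEq (X j)]
  {P : ∀ j, X j → X j → ℝ} {π : ∀ j, X j → ℝ} {w β : Fin d → ℝ}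

omit [∀ j, Fintype (X j)] [∀ j, DecidableEq (X j)] in
/-- Agreement off one coordinate is symmetric: `y = z^{k←y_k} ↔ z = y^{k←z_k}`. -/
theorem eq_update_comm (k : Fin d) (y z : ∀ j, X j) : y = update z k (y k) ↔ z = update y k (z k) := by
  constructor
  · intro h; funext i
    by_cases hi : i = k
    · subst hi; rw [update_self]
    · rw [update_of_ne hi]; have := congrFun h i; rw [update_of_ne hi] at this; exact this.symm
  · intro h; funext i
    by_cases hi : i = k
    · subst hi; rw [update_self]
    · rw [update_of_ne hi]; have := congrFun h i; rw [update_of_ne hi] at this; exact this.symm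

/-- **Column sums of a coordinate kernel:** `Σ_z F(z)·P̃_k(z,y) = Σ_v F(y^{k←v})·P_k(v, y_k)`. [ours] -/
theorem sum_mul_coordKernel (P : ∀ j, X j → X j → ℝ) (k : Fin d) (y : ∀ j, X j) (F : (∀ j, X j) → ℝ) :
    ∑ z, F z * coordKernel P k z y = ∑ v, F (update y k v) * P k v (y k) := by
  have h1 : ∀ z : ∀ j, X j, F z * coordKernel P k z y
      = ∑ v, if z = update y k v then F z * P k v (y k) else 0 := by
    intro z
    rw [Finset.sum_eq_single (z k)]
    · unfold coordKernel
      by_cases h : y = update z k (y k)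
      · rw [if_pos h, if_pos ((eq_update_comm k y z).mp h)]
      · rw [if_neg h, if_neg (fun h' => h ((eq_update_comm k y z).mpr h')), mul_zero]
    · intro v _ hv
      rw [if_neg]
      intro hz
      apply hv
      have := congrFun hz k
      rw [update_self] at this
      exact this.symm
    · intro h; exact absurd (mem_univ _) h
  rw [sum_congr rfl fun z _ => h1 z, sum_comm]
  refine sum_congr rfl fun v _ => ?_
  rw [sum_ite_eq' univ (update y k v), if_pos (mem_univ _)]

/-- **`T_jv·P̃_k = T_{jv+e_k}`** for the tensor kernel `T_jv(x,y) = Π_i P_i^{jv_i}(x_i,y_i)` of independent offsets. [ours] -/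
theorem tensorPow_mul_coordKernel (P : ∀ j, X j → X j → ℝ) (jv : Fin d → ℕ) (k : Fin d) (x y : ∀ j, X j) :
    ∑ z, (∏ i, ((Matrix.of (P i)) ^ jv i) (x i) (z i)) * coordKernel P k z y
      = ∏ i, ((Matrix.of (P i)) ^ (update jv k (jv k + 1)) i) (x i) (y i) := by
  rw [sum_mul_coordKernel P k y]
  -- split off the factor `i = k` on both sides
  have hsplit : ∀ (v : X k), (∏ i, ((Matrix.of (P i)) ^ jv i) (x i) (update y k v i))
      = ((Matrix.of (P k)) ^ jv k) (x k) v * ∏ i ∈ univ.erase k, ((Matrix.of (P i)) ^ jv i) (x i) (y i) := by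
    intro v
    rw [← mul_prod_erase univ _ (mem_univ k), update_self]
    congr 1
    exact prod_congr rfl fun i hi => by rw [update_of_ne (ne_of_mem_erase hi)]
  have hsplit' : (∏ i, ((Matrix.of (P i)) ^ (update jv k (jv k + 1)) i) (x i) (y i))
      = ((Matrix.of (P k)) ^ (jv k + 1)) (x k) (y k) * ∏ i ∈ univ.erase k, ((Matrix.of (P i)) ^ jv i) (x i) (y i) := by
    rw [← mul_prod_erase univ _ (mem_univ k), update_self]
    congr 1
    exact prod_congr rfl fun i hi => by rw [update_of_ne (ne_of_mem_erase hi)]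
  simp_rw [hsplit]
  rw [hsplit', pow_succ, Matrix.mul_apply, sum_mul]
  refine sum_congr rfl fun v _ => ?_
  rw [Matrix.of_apply]
  ring

/-- **THE INDUCTION:** `(T_jvQⁿ)(x,y) ≥ (1 − Σ_k (1−β_k)^{jv_k}(1 − w_kβ_k)ⁿ)·π̃(y)` for minorised stationary coordinates (`0 ≤ β ≤ 1`, `w ≥ 0`,
`Σw = 1`, `π_k > 0`). [ours] -/
theorem tensorPow_mul_prodKernel_pow_ge (hP : ∀ j, IsRowStochastic (P j)) (hst : ∀ j, IsStationary (π j) (P j))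
    (hπ : ∀ j u, 0 < π j u) (hπ1 : ∀ j, ∑ u, π j u = 1) (hβ0 : ∀ j, 0 ≤ β j) (hβ1 : ∀ j, β j ≤ 1)
    (hmin : ∀ j u v, β j * π j v ≤ P j u v) (hw0 : ∀ j, 0 ≤ w j) (hw1 : ∑ j, w j = 1) :
    ∀ (n : ℕ) (jv : Fin d → ℕ) (x y : ∀ j, X j),
      (1 - ∑ k, (1 - β k) ^ jv k * (1 - w k * β k) ^ n) * tensorFun π y
        ≤ ∑ z, (∏ i, ((Matrix.of (P i)) ^ jv i) (x i) (z i)) * ((Matrix.of (prodKernel w P)) ^ n) z y := by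
  have hT0 : ∀ (jv : Fin d → ℕ) (x z : ∀ j, X j), 0 ≤ ∏ i, ((Matrix.of (P i)) ^ jv i) (x i) (z i) := fun jv x z =>
    prod_nonneg fun i _ => ((hP i).matPow (jv i)).1 _ _
  intro n
  induction n with
  | zero =>
    intro jv x y
    simp only [pow_zero, Matrix.one_apply, mul_ite, mul_one, mul_zero, sum_ite_eq' univ y, if_pos (mem_univ _)]
    -- `T_jv(x,y) ≥ Π_k (1 − (1−β_k)^{jv_k})π_k(y_k) ≥ (1 − Σ_k (1−β_k)^{jv_k})·π̃(y)`
    have h1 : ∏ i, (1 - (1 - β i) ^ jv i) * π i (y i) ≤ ∏ i, ((Matrix.of (P i)) ^ jv i) (x i) (y i) :=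
      prod_le_prod (fun i _ => mul_nonneg (sub_nonneg.mpr (pow_le_one₀ (by linarith [hβ1 i]) (by linarith [hβ0 i])))
        (hπ i _).le) (fun i _ => pow_apply_ge_of_minorized (hP i) (hst i) (hπ1 i) (hmin i) (jv i) (x i) (y i))
    refine le_trans ?_ h1
    rw [prod_mul_distrib]
    refine mul_le_mul_of_nonneg_right ?_ (tensorFun_pos hπ y).le
    exact one_sub_sum_le_prod univ (fun i _ => pow_nonneg (by linarith [hβ1 i]) _)
      (fun i _ => pow_le_one₀ (by linarith [hβ1 i]) (by linarith [hβ0 i]))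
  | succ n ih =>
    intro jv x y
    -- `T_jvQ^{n+1} = Σ_{k'} w_{k'} T_{jv+e_{k'}} Qⁿ`
    have hstep : ∑ z, (∏ i, ((Matrix.of (P i)) ^ jv i) (x i) (z i)) * ((Matrix.of (prodKernel w P)) ^ (n + 1)) z y
        = ∑ k', w k' * ∑ u, (∏ i, ((Matrix.of (P i)) ^ (update jv k' (jv k' + 1)) i) (x i) (u i))
            * ((Matrix.of (prodKernel w P)) ^ n) u y := by
      have h1 : ∀ z, ((Matrix.of (prodKernel w P)) ^ (n + 1)) z y
          = ∑ u, (∑ k', w k' * coordKernel P k' z u) * ((Matrix.of (prodKernel w P)) ^ n) u y := by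
        intro z; rw [pow_succ', Matrix.mul_apply]; rfl
      calc ∑ z, (∏ i, ((Matrix.of (P i)) ^ jv i) (x i) (z i)) * ((Matrix.of (prodKernel w P)) ^ (n + 1)) z y
          = ∑ z, ∑ u, ∑ k', w k' * ((∏ i, ((Matrix.of (P i)) ^ jv i) (x i) (z i)) * coordKernel P k' z u
              * ((Matrix.of (prodKernel w P)) ^ n) u y) := by
            refine sum_congr rfl fun z _ => ?_
            rw [h1 z, mul_sum]
            refine sum_congr rfl fun u _ => ?_
            rw [sum_mul, mul_sum]
            exact sum_congr rfl fun k' _ => by ring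
        _ = ∑ u, ∑ k', ∑ z, w k' * ((∏ i, ((Matrix.of (P i)) ^ jv i) (x i) (z i)) * coordKernel P k' z u
              * ((Matrix.of (prodKernel w P)) ^ n) u y) := by
            rw [sum_comm]; exact sum_congr rfl fun u _ => sum_comm
        _ = ∑ k', ∑ u, ∑ z, w k' * ((∏ i, ((Matrix.of (P i)) ^ jv i) (x i) (z i)) * coordKernel P k' z u
              * ((Matrix.of (prodKernel w P)) ^ n) u y) := sum_comm
        _ = ∑ k', w k' * ∑ u, (∏ i, ((Matrix.of (P i)) ^ (update jv k' (jv k' + 1)) i) (x i) (u i))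
              * ((Matrix.of (prodKernel w P)) ^ n) u y := by
            refine sum_congr rfl fun k' _ => ?_
            rw [mul_sum]
            refine sum_congr rfl fun u _ => ?_
            rw [← tensorPow_mul_coordKernel P jv k' x u, sum_mul, mul_sum]
    rw [hstep]
    -- apply the induction hypothesis to each `k'`
    have hIH : ∀ k', (1 - ∑ k, (1 - β k) ^ (update jv k' (jv k' + 1)) k * (1 - w k * β k) ^ n) * tensorFun π y
        ≤ ∑ u, (∏ i, ((Matrix.of (P i)) ^ (update jv k' (jv k' + 1)) i) (x i) (u i)) * ((Matrix.of (prodKernel w P)) ^ n) u y :=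
      fun k' => ih (update jv k' (jv k' + 1)) x y
    have hsum : ∑ k', w k' * ((1 - ∑ k, (1 - β k) ^ (update jv k' (jv k' + 1)) k * (1 - w k * β k) ^ n) * tensorFun π y)
        = (1 - ∑ k, (1 - β k) ^ jv k * (1 - w k * β k) ^ (n + 1)) * tensorFun π y := by
      -- `(1−β_k)^{(jv+e_{k'})_k} = (1−β_k)^{jv_k}·(1−β_k)^{[k=k']}` and `Σ_{k'} w_{k'}(1−β_k)^{[k=k']} = 1 − w_kβ_k`
      have hpow : ∀ k' k, (1 - β k) ^ (update jv k' (jv k' + 1)) k = (1 - β k) ^ jv k * (if k = k' then (1 - β k) else 1) := by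
        intro k' k
        by_cases hk : k = k'
        · subst hk; rw [update_self, pow_succ, if_pos rfl]
        · rw [update_of_ne hk, if_neg hk, mul_one]
      simp_rw [hpow]
      have hinner : ∀ k, ∑ k', w k' * ((1 - β k) ^ jv k * (if k = k' then (1 - β k) else 1) * (1 - w k * β k) ^ n)
          = (1 - β k) ^ jv k * (1 - w k * β k) ^ (n + 1) := by
        intro k
        have h2 : ∀ k', w k' * ((1 - β k) ^ jv k * (if k = k' then (1 - β k) else 1) * (1 - w k * β k) ^ n)
            = (1 - β k) ^ jv k * (1 - w k * β k) ^ n * w k' - (if k = k' then (1 - β k) ^ jv k * (1 - w k * β k) ^ n * w k * β k else 0) := by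
          intro k'
          by_cases hk : k = k'
          · subst hk; rw [if_pos rfl, if_pos rfl]; ring
          · rw [if_neg hk, if_neg hk]; ring
        rw [sum_congr rfl fun k' _ => h2 k', sum_sub_distrib, ← mul_sum, hw1, sum_ite_eq univ k, if_pos (mem_univ _), pow_succ]
        ring
      have hL : ∑ k', w k' * ((1 - ∑ k, (1 - β k) ^ jv k * (if k = k' then (1 - β k) else 1) * (1 - w k * β k) ^ n) * tensorFun π y)
          = (∑ k', w k' * (1 - ∑ k, (1 - β k) ^ jv k * (if k = k' then (1 - β k) else 1) * (1 - w k * β k) ^ n)) * tensorFun π y := by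
        rw [sum_mul]; exact sum_congr rfl fun k' _ => by ring
      have hM : ∑ k', w k' * (1 - ∑ k, (1 - β k) ^ jv k * (if k = k' then (1 - β k) else 1) * (1 - w k * β k) ^ n)
          = 1 - ∑ k, (1 - β k) ^ jv k * (1 - w k * β k) ^ (n + 1) := by
        calc ∑ k', w k' * (1 - ∑ k, (1 - β k) ^ jv k * (if k = k' then (1 - β k) else 1) * (1 - w k * β k) ^ n)
            = ∑ k', w k' - ∑ k', ∑ k, w k' * ((1 - β k) ^ jv k * (if k = k' then (1 - β k) else 1) * (1 - w k * β k) ^ n) := by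
              rw [← sum_sub_distrib]
              exact sum_congr rfl fun k' _ => by rw [mul_sub, mul_one, mul_sum]
          _ = 1 - ∑ k, ∑ k', w k' * ((1 - β k) ^ jv k * (if k = k' then (1 - β k) else 1) * (1 - w k * β k) ^ n) := by
              rw [hw1, sum_comm]
          _ = 1 - ∑ k, (1 - β k) ^ jv k * (1 - w k * β k) ^ (n + 1) := by
              rw [sum_congr rfl fun k _ => hinner k]
      rw [hL, hM]
    rw [← hsum]
    exact sum_le_sum fun k' _ => mul_le_mul_of_nonneg_left (hIH k') (hw0 k')

/-- **`Qⁿ(x,y) ≥ (1 − Σ_k (1 − w_kβ_k)ⁿ)·π̃(y)`** for a random-scan product of minorised stationary kernels. [ours] -/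
theorem prodKernel_pow_ge_tensorFun (hP : ∀ j, IsRowStochastic (P j)) (hst : ∀ j, IsStationary (π j) (P j))
    (hπ : ∀ j u, 0 < π j u) (hπ1 : ∀ j, ∑ u, π j u = 1) (hβ0 : ∀ j, 0 ≤ β j) (hβ1 : ∀ j, β j ≤ 1)
    (hmin : ∀ j u v, β j * π j v ≤ P j u v) (hw0 : ∀ j, 0 ≤ w j) (hw1 : ∑ j, w j = 1) (n : ℕ) (x y : ∀ j, X j) :
    (1 - ∑ k, (1 - w k * β k) ^ n) * tensorFun π y ≤ ((Matrix.of (prodKernel w P)) ^ n) x y := by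
  have h := tensorPow_mul_prodKernel_pow_ge hP hst hπ hπ1 hβ0 hβ1 hmin hw0 hw1 n (fun _ => 0) x y
  simp only [pow_zero, one_mul, Matrix.one_apply] at h
  -- `T_0(x,z) = 𝟙{x = z}` coordinatewise: `Π_i 𝟙{x_i = z_i}`
  have hT : ∀ z : ∀ j, X j, (∏ i, (if x i = z i then (1 : ℝ) else 0)) = if x = z then 1 else 0 := by
    intro z
    by_cases hxz : x = z
    · rw [if_pos hxz]; exact prod_eq_one fun i _ => if_pos (congrFun hxz i)
    · rw [if_neg hxz]
      obtain ⟨i, hi⟩ : ∃ i, x i ≠ z i := by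
        by_contra hall; push Not at hall; exact hxz (funext hall)
      exact prod_eq_zero (mem_univ i) (if_neg hi)
  simp_rw [hT] at h
  simp only [ite_mul, one_mul, zero_mul, sum_ite_eq univ x, if_pos (mem_univ _)] at h
  exact h

/-- **`d(n) ≤ Σ_k (1 − w_kβ_k)ⁿ`** for a random-scan product of minorised REVERSIBLE kernels (`d ≥ 1` coordinates, `π_k`-reversible, `π_k > 0`).
[ours] -/
theorem prodKernel_worstTvDist_le_sum [∀ j, Nonempty (X j)] (hd : 0 < d) (hP : ∀ j, IsRowStochastic (P j))
    (hDB : ∀ j, DetailedBalance (π j) (P j)) (hπ : ∀ j u, 0 < π j u) (hπ1 : ∀ j, ∑ u, π j u = 1) (hβ0 : ∀ j, 0 ≤ β j)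
    (hβ1 : ∀ j, β j ≤ 1) (hmin : ∀ j u v, β j * π j v ≤ P j u v) (hw0 : ∀ j, 0 ≤ w j) (hw1 : ∑ j, w j = 1) (n : ℕ) :
    worstTvDist (prodKernel w P) (tensorFun π) n ≤ ∑ k, (1 - w k * β k) ^ n := by
  have hst : ∀ j, IsStationary (π j) (P j) := fun j => (hDB j).isStationary (hP j).2
  have hQ : IsRowStochastic (prodKernel w P) := prodKernel_isRowStochastic P w hw0 hw1 hP
  have hQst : IsStationary (tensorFun π) (prodKernel w P) := (prodKernel_detailedBalance hDB w).isStationary hQ.2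
  have hD : DoeblinCondition (Matrix.of (prodKernel w P)) n (1 - ∑ k, (1 - w k * β k) ^ n) (tensorFun π) :=
    ⟨fun z => (tensorFun_pos hπ z).le, sum_tensorFun_eq_one π hπ1,
      fun x y => prodKernel_pow_ge_tensorFun hP hst hπ hπ1 hβ0 hβ1 hmin hw0 hw1 n x y⟩
  have hvec : tensorFun π ᵥ* Matrix.of (prodKernel w P) = tensorFun π := funext fun j => hQst j
  refine ciSup_le fun x => ?_
  have hrow : lawAt (prodKernel w P) (Pi.single x 1) n = fun j => ((Matrix.of (prodKernel w P)) ^ n) x j :=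
    funext fun j => kernelAt_eq_pow_apply (Matrix.of (prodKernel w P)) n x j
  rw [hrow]
  rcases Nat.eq_zero_or_pos n with hn | hn
  · subst hn
    refine (tvDist_le_one (fun j => ((hQ.matPow 0).1 x j)) (fun z => (tensorFun_pos hπ z).le) ((hQ.matPow 0).2 x)
      (sum_tensorFun_eq_one π hπ1)).trans ?_
    rw [show ∑ k : Fin d, (1 - w k * β k) ^ 0 = (d : ℝ) by simp]
    exact_mod_cast hd
  · have h := Saloffcoste1997_thm_1_2_7_tvDist (M := Matrix.of (prodKernel w P)) hQ hD (fun z => (tensorFun_pos hπ z).le)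
      (sum_tensorFun_eq_one π hπ1) hvec x n
    rwa [Nat.div_self hn, pow_one, sub_sub_cancel] at h

end Product

/-! ## §2 The refresh-then-propose tempering star = `K` independence samplers -/

section Refresh
variable {S : Type*} [Fintype S] [DecidableEq S] {K : ℕ} {μ : Fin (K + 1) → S → ℝ} {p : ℝ}
variable (φ : Fin K → Equiv.Perm S)

/-- **The level-`k` move of the refresh-then-propose star is minorised by `p·μ_k`:** a fresh `ξ ~ μ_0`, the proposal `φ_k ξ` (law
`μ_0∘φ_k⁻¹`) and the Metropolis–Hastings ratio form an independence sampler with weights `μ_k/(μ_0∘φ_k⁻¹) ≤ 1/p` under the one-sided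
domination `p·μ_k(φ_k u) ≤ μ_0(u)` (Mengersen–Tweedie, in the tree). [ours] -/
theorem refreshThenPropose_minorized (hμ : ∀ k x, 0 < μ k x) (hμ1 : ∀ k, ∑ u, μ k u = 1) (hp : 0 < p)
    (hdom : ∀ (k : Fin K) (u : S), p * μ k.succ (φ k u) ≤ μ 0 u) (k : Fin K) (u v : S) :
    p * μ k.succ v ≤ mhKernel (fun _ z : S => μ 0 ((φ k).symm z)) (μ k.succ) u v := by
  have hq1 : ∑ z, μ 0 ((φ k).symm z) = 1 := by rw [Equiv.sum_comp (φ k).symm (μ 0)]; exact hμ1 0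
  have hW : ∀ z, μ k.succ z ≤ 1 / p * μ 0 ((φ k).symm z) := fun z => by
    rw [one_div, le_inv_mul_iff₀ hp]
    have h := hdom k ((φ k).symm z)
    rwa [Equiv.apply_symm_apply] at h
  have h := imh_minorized (p := μ k.succ) (q := fun z => μ 0 ((φ k).symm z)) (hμ k.succ) (fun z => (hμ 0 _).le) hq1 hW u v
  rwa [one_div, inv_inv] at h

/-- **`d(n) ≤ Σ_k (1 − w′_k·p)ⁿ` FOR THE REFRESH-THEN-PROPOSE STAR** (`K ≥ 1` levels with targets `μ_k`, weights `w′ ≥ 0`, `Σw′ = 1`, maps with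
`p·μ_k(φ_k u) ≤ μ_0(u)`, `0 < p ≤ 1`) — volume-free, regime-free, polynomial in `K`. [ours] -/
theorem refreshThenPropose_worstTvDist_le [Nonempty S] (hK : 1 ≤ K) (hμ : ∀ k x, 0 < μ k x) (hμ1 : ∀ k, ∑ u, μ k u = 1)
    (hp : 0 < p) (hp1 : p ≤ 1) (hdom : ∀ (k : Fin K) (u : S), p * μ k.succ (φ k u) ≤ μ 0 u) {w' : Fin K → ℝ}
    (hw0 : ∀ k, 0 ≤ w' k) (hw1 : ∑ k, w' k = 1) (n : ℕ) :
    worstTvDist (prodKernel w' (fun k : Fin K => mhKernel (fun _ z : S => μ 0 ((φ k).symm z)) (μ k.succ)))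
        (tensorFun (fun k : Fin K => μ k.succ)) n ≤ ∑ k, (1 - w' k * p) ^ n := by
  have hq : ∀ k : Fin K, (∀ a b : S, 0 ≤ (fun _ z : S => μ 0 ((φ k).symm z)) a b) ∧
      (∀ a : S, ∑ b, (fun _ z : S => μ 0 ((φ k).symm z)) a b ≤ 1) := fun k =>
    ⟨fun _ z => (hμ 0 _).le, fun _ => by rw [Equiv.sum_comp (φ k).symm (μ 0)]; exact (hμ1 0).le⟩
  exact prodKernel_worstTvDist_le_sum (X := fun _ : Fin K => S) (by omega)
    (fun k => mhKernel_isRowStochastic (hq k).1 (hq k).2 (hμ k.succ))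
    (fun k => mhKernel_detailedBalance (hμ k.succ) _) (fun k u => hμ k.succ u) (fun k => hμ1 k.succ)
    (fun _ => hp.le) (fun _ => hp1) (fun k u v => refreshThenPropose_minorized φ hμ hμ1 hp hdom k u v) hw0 hw1 n

/-- **`t_mix(ε) ≤ ⌈(K/p)·log(K/ε)⌉` FOR THE REFRESH-THEN-PROPOSE STAR AT UNIFORM WEIGHTS** (`0 < ε`): `d(n) ≤ K(1 − p/K)ⁿ ≤ K·e^{−pn/K}`.
[ours] -/
theorem refreshThenPropose_mixingTime_le [Nonempty S] (hK : 1 ≤ K) (hμ : ∀ k x, 0 < μ k x) (hμ1 : ∀ k, ∑ u, μ k u = 1)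
    (hp : 0 < p) (hp1 : p ≤ 1) (hdom : ∀ (k : Fin K) (u : S), p * μ k.succ (φ k u) ≤ μ 0 u) {ε : ℝ} (hε : 0 < ε) :
    mixingTime (prodKernel (fun _ : Fin K => (1 : ℝ) / K) (fun k : Fin K => mhKernel (fun _ z : S => μ 0 ((φ k).symm z)) (μ k.succ)))
        (tensorFun (fun k : Fin K => μ k.succ)) ε ≤ ⌈(K : ℝ) / p * Real.log (K / ε)⌉₊ := by
  have hKpos : (0 : ℝ) < K := Nat.cast_pos.mpr (by omega)
  set n : ℕ := ⌈(K : ℝ) / p * Real.log (K / ε)⌉₊ with hn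
  refine mixingTime_le _ _ ((refreshThenPropose_worstTvDist_le φ hK hμ hμ1 hp hp1 hdom (w' := fun _ : Fin K => (1 : ℝ) / K)
    (fun _ => by positivity) (by rw [sum_const, card_univ, Fintype.card_fin, nsmul_eq_mul]; field_simp) n).trans ?_)
  rw [sum_const, card_univ, Fintype.card_fin, nsmul_eq_mul]
  -- `K(1 − p/K)ⁿ ≤ K·e^{−(p/K)n} ≤ K·(ε/K) = ε`
  have hθ0 : 0 ≤ 1 - 1 / (K : ℝ) * p := by
    rw [sub_nonneg, one_div, inv_mul_le_iff₀ hKpos, mul_one]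
    exact hp1.trans (by exact_mod_cast hK)
  have hnge : (K : ℝ) / p * Real.log (K / ε) ≤ n := Nat.le_ceil _
  have hpow : (1 - 1 / (K : ℝ) * p) ^ n ≤ Real.exp (-(1 / (K : ℝ) * p * n)) := by
    calc (1 - 1 / (K : ℝ) * p) ^ n ≤ Real.exp (-(1 / (K : ℝ) * p)) ^ n :=
          pow_le_pow_left₀ hθ0 (by have := Real.one_sub_le_exp_neg (1 / (K : ℝ) * p); linarith) n
      _ = Real.exp (-(1 / (K : ℝ) * p * n)) := by rw [← Real.exp_nat_mul]; ring_nf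
  have hexp : Real.exp (-(1 / (K : ℝ) * p * n)) ≤ ε / K := by
    have h1 : Real.log (K / ε) ≤ 1 / (K : ℝ) * p * n := by
      have := mul_le_mul_of_nonneg_left hnge (by positivity : (0 : ℝ) ≤ p / K)
      rw [← mul_assoc, show p / (K : ℝ) * (K / p) = 1 by field_simp, one_mul] at this
      calc Real.log (K / ε) ≤ p / K * n := this
        _ = 1 / (K : ℝ) * p * n := by ring
    calc Real.exp (-(1 / (K : ℝ) * p * n)) ≤ Real.exp (-Real.log (K / ε)) := Real.exp_le_exp.mpr (by linarith)
      _ = ε / K := by rw [Real.exp_neg, Real.exp_log (by positivity), inv_div]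
  calc (K : ℝ) * (1 - 1 / (K : ℝ) * p) ^ n ≤ K * (ε / K) := mul_le_mul_of_nonneg_left (hpow.trans hexp) hKpos.le
    _ = ε := by field_simp

end Refresh

end Summit.Ventures.LatticeQCDFlow.Scaling

end
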